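import Mathlib
import Summits.CriticalPhenomena.PercolationContinuityZ3.Theorems.PercNearOneGluingNoHeavyLowerTailHexMS
import Summits.CriticalPhenomena.PercolationContinuityZ3.Theorems.PercNearOneGluingNoHeavyLowerTailTypedSectioningSymmetric

/-!
# HEX-MS from a sectioning certificate of the symmetric pair system (hp-7 gen 82)

Helper file for crux `stmt-CriticalPhenomena-4575` (`NoHeavyLowerTail`, route `PercNearOneGluingNoHeavy`), hull-port seat
`prim-hp-7` (generation 82); `--supports stmt-CriticalPhenomena-4575 --as helper`.  Pure finite set theory; everything is PROVED.
Memo: `run/shared/lean/prim/prim-hp-7/FROM-prim-hp-7-g82-GENERAL-ALLOCATION.md` §0 (H).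

`GeneratedDonors.HexMSAt 𝒟 x` (`…LowerTailHexMS`, hp-7 g64) asks `#𝒟 ≤ 2 · #(gen 𝒟 x)` for a complement-closed family `𝒟 ⊆ 2^α` with an
antipodal `ZMod 6`-labelling `x` — the pure core of Conjecture K♯.  Here the typed-sectioning vehicle of gen 81/82 is connected to it:
fix a base point `u₀`; every complementary pair `{a, univ \ a}` of `𝒟` is a minuend (represented by its member avoiding `u₀`,
`TypedSectioning.crep univ u₀`), allowed to use the representatives of all close differences `a \ b`, `(univ \ a) \ b` (`b ∈ 𝒟` with a
label close to that of the respective member) — `hexA`.  A general-allocation certificate (`TypedSectioning.PCert`) of this system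
gives `HexMSAt 𝒟 x` (`hexMSAt_of_pcert`): the number of pairs is at most the number of complement classes of `gen 𝒟 x`, which is at
most `#(gen 𝒟 x)`.

Census (memo §0 (H)): with the canonical Ahlswede–Daykin children (no allocation freedom) this system is certified for ALL 2 400
antipodal labellings on `2^[3]` (every coordinate works at the root), for 10 000 random labellings on `2^[4]`, `2^[5]` (0 failures;
exhaustive `2^[4]` = kit j298243), and for the debtor families of random monotone maps `2^[n] → 𝓗`, `n ≤ 5` (MS♯).  The uniform
theorem — a sectioning strategy valid for every antipodal labelling — would prove HEX-MS; this file is its vehicle.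
-/

namespace Summit.CriticalPhenomena.PercolationContinuityZ3.Theorems

namespace TypedSectioning

open Finset GeneratedDonors

variable {α : Type*} [Fintype α] [DecidableEq α]

/-- The symmetric HEX pair system: the representative `R` of a complementary pair of `𝒟` may use the representatives of the close
differences of both members of the pair. -/
def hexA (u₀ : α) (𝒟 : Finset (Finset α)) (x : Finset α → ZMod 6) : Finset α → Finset (Finset α) := fun R =>
  (𝒟.filter fun a => crep univ u₀ a = R).biUnion fun a =>
    ((𝒟.filter fun b => Close (x a) (x b)).image fun b => a \ b).image (crep univ u₀)

/-- The terms of the HEX pair system are representatives of generated differences. -/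
theorem pterms_hexA_subset (u₀ : α) (𝒟 : Finset (Finset α)) (x : Finset α → ZMod 6) :
    pterms (𝒟.image (crep univ u₀)) (hexA u₀ 𝒟 x) ⊆ (gen 𝒟 x).image (crep univ u₀) := by
  intro E hE
  obtain ⟨R, -, hER⟩ := mem_pterms.mp hE
  unfold hexA at hER
  simp only [mem_biUnion, mem_filter, mem_image] at hER
  obtain ⟨a, ⟨ha, -⟩, t, ⟨b, ⟨hb, hcl⟩, rfl⟩, rfl⟩ := hER
  exact mem_image.mpr ⟨a \ b, mem_gen.mpr ⟨a, ha, b, hb, hcl, rfl⟩, rfl⟩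

/-- A complement-closed family has exactly twice as many members as complementary pairs (representatives avoiding `u₀`). -/
theorem card_eq_two_mul_card_image_crep (u₀ : α) (𝒟 : Finset (Finset α)) (hco : ∀ a ∈ 𝒟, univ \ a ∈ 𝒟) :
    #𝒟 = 2 * #(𝒟.image (crep univ u₀)) := by
  classical
  set D₀ := 𝒟.filter fun a => u₀ ∉ a with hD₀
  set D₁ := 𝒟.filter fun a => u₀ ∈ a with hD₁
  have hcc : ∀ s : Finset α, univ \ (univ \ s) = s := fun s => Finset.sdiff_sdiff_eq_self (subset_univ s)
  have himg : 𝒟.image (crep univ u₀) = D₀ := by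
    ext R
    simp only [mem_image, hD₀, mem_filter]
    constructor
    · rintro ⟨a, ha, rfl⟩
      unfold crep
      split_ifs with h
      · exact ⟨hco a ha, fun h' => (mem_sdiff.mp h').2 h⟩
      · exact ⟨ha, h⟩
    · rintro ⟨hR, hu⟩
      exact ⟨R, hR, by unfold crep; rw [if_neg hu]⟩
  have hbij : D₁.image (fun a => univ \ a) = D₀ := by
    ext R
    simp only [mem_image, hD₀, hD₁, mem_filter]
    constructor
    · rintro ⟨a, ⟨ha, hu⟩, rfl⟩
      exact ⟨hco a ha, fun h' => (mem_sdiff.mp h').2 hu⟩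
    · rintro ⟨hR, hu⟩
      refine ⟨univ \ R, ⟨hco R hR, mem_sdiff.mpr ⟨mem_univ _, hu⟩⟩, hcc R⟩
  have hinj : Set.InjOn (fun a : Finset α => univ \ a) ↑D₁ := by
    intro a _ b _ h
    have h' := congrArg (fun s => univ \ s) h
    simp only [hcc] at h'
    exact h'
  have h1 : #D₁ = #D₀ := by rw [← hbij, card_image_of_injOn hinj]
  have hsplit : #D₁ + #D₀ = #𝒟 := by
    rw [hD₁, hD₀]; exact card_filter_add_card_filter_not (s := 𝒟) (fun a => u₀ ∈ a)
  rw [himg]; omega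

/-- **HEX-MS from a certificate** (hp-7 gen 82): if the symmetric HEX pair system of `(𝒟, x)` is certified for some base point `u₀`,
then `HexMSAt 𝒟 x` holds — the complementary pairs of `𝒟` number at most the complement classes of `gen 𝒟 x`, hence at most
`#(gen 𝒟 x)`. -/
theorem hexMSAt_of_pcert (𝒟 : Finset (Finset α)) (x : Finset α → ZMod 6) (u₀ : α)
    (hcert : PCert (𝒟.image (crep univ u₀)) (hexA u₀ 𝒟 x)) : HexMSAt 𝒟 x := by
  intro hco _
  have h1 := card_eq_two_mul_card_image_crep u₀ 𝒟 hco
  have h2 : #(𝒟.image (crep univ u₀)) ≤ #((gen 𝒟 x).image (crep univ u₀)) :=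
    card_le_card_of_pcert hcert (pterms_hexA_subset u₀ 𝒟 x)
  have h3 : #((gen 𝒟 x).image (crep univ u₀)) ≤ #(gen 𝒟 x) := card_image_le
  omega

end TypedSectioning

end Summit.CriticalPhenomena.PercolationContinuityZ3.Theorems
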